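import Mathlib.Analysis.SpecialFunctions.Pow.Real
import Mathlib.Analysis.SpecificLimits.Basic
import Summits.AnomalousDissipation.AnomalousDissipation.Theorems.SolenoidalFractalHomogenisationLagrangianStepTailScales
import HarnessLib

/-!
# Template asymptotics of the super-geometric carrier: the `m⋆` bookkeeping of the one-level step (K1L_D helper)

Helper file of route `SolenoidalFractalHomogenisation`, crux K1L_D `LagrangianRenormalisationStepDesign` (stmt-AnomalousDissipation-27980),
registered stub `stub_oneLevelL_IW` (skeleton «onelevel-design» v2): the conclusion of that stub chooses, for every carrier `E` on the template
and every length-scale class `R`, a level `m⋆` beyond which the one-level comparison holds with ratio `1 − C₁ (N m / N (m+1))^{σ₁}`.  Every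
threshold in that choice is a statement about the BOOKKEEPING DATA `D = E.toFractalCarrierData` alone, under the clauses the stub carries as
hypotheses — `Permissible` (so `N 0 = 1`, `2 N m ≤ N (m+1)`, the Taylor recursion), super-geometry `N m ^ 2 ≤ N (m+1)`, the viscous windows
(T2) `cellVisc (m+1) · (N (m+1)/N m)^{1/4} ≤ 1` and (T3) `K · (N (m+1)/N m)^{1/4} ≤ (N (m+1)/N m) · cellVisc (m+1)`.  This file proves them once,
in the variable `s_m := (N (m+1) / N m)^{1/16}` of the template (so that `ρ_m = N m / N (m+1) = s_m⁻¹⁶` and every clause is polynomial in `s_m`,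
as in the lead's consumer memo `Cruxes/LagrangianRenormalisationStep/B-lead-1.md` and p4's `activeBand_exponent_le`):

* § 1 `s_m ≥ 1`, `s_m ^ 16 = N (m+1)/N m`, `s_m ^ 4 = (N (m+1)/N m)^{1/4}`, `N m ≤ s_m ^ 16` and `2 ^ m ≤ N m ≤ s_m ^ 16`; `s_m → ∞`;
  thresholds `∀ B, ∃ m⋆, ∀ m ≥ m⋆, B ≤ s_m` and `∀ σ > 0, ∀ ε > 0, ∃ m⋆, ∀ m ≥ m⋆, C · (N m / N (m+1)) ^ σ ≤ ε` (the error law `C₁ ρ^{σ₁}`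
  is eventually below any `ε`, in particular eventually `≤ 1/2`);
* § 2 the cell viscosity of level `m+1` is PINCHED: `K / s_m ^ 12 ≤ cellVisc (m+1) ≤ 1 / s_m ^ 4` ((T3), (T2)); hence `⌈K / cellVisc (m+1)⌉₊ ≤
  s_m ^ 12 + 1` and the ACTIVE BAND FITS under the Bloch threshold: `L ≤ N m · s_m ^ 2` and `2 ≤ s_m ^ 2` give `L · ⌈K / cellVisc (m+1)⌉₊ ≤ N (m+1)`
  (the hypothesis `‖ℓ‖ ⌈K/ν⌉ ≤ n` of the cell clauses (V)/(C) for the modes `‖ℓ‖ ≤ N m ρ^{-1/8}`);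
* (companion file `…LagrangianStepTemplateDissipationScale`: § 3 the relative gain `gain / cellVisc (m+1)²` is large, § 4 the dissipation
  scale `R_m := kbar m · N m²` tends to infinity.)

Pure real arithmetic on `FractalCarrierData` (no carrier analysis, no definitions, no named facts, no sorry); cites only the bookkeeping of
[ArmstrongVicol2025, §3 (3.42)–(3.43)] through the tree's `Permissible`.  This is NOT a proof of the one-level comparison, of the crux, of
Onsager's conjecture or of anomalous dissipation — rung-leaf F-D1.A0 bookkeeping only.  Prover seat `ad-k3l-bookkeeping-p1` g4, 2026-08-28.
-/

set_option linter.dupNamespace false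

noncomputable section

namespace Summit.AnomalousDissipation.AnomalousDissipation.Theorems.SolenoidalFractalHomogenisation.LagrangianStep

open Filter Topology
open Literature.Analysis.FluidPDE.LatticeShear
open Summit.AnomalousDissipation.AnomalousDissipation.Theorems.SolenoidalFractalHomogenisation.LagrangianRenormalisationStep (cellVisc_pos')

variable {k : ℕ} (D : FractalCarrierData k)

/-! ## § 1. The separation variable `s_m = (N (m+1) / N m)^{1/16}` -/

/-- `0 < N (m+1) / N m`. [folklore] -/
theorem ratio_pos (m : ℕ) : 0 < (D.N (m + 1) : ℝ) / D.N m := by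
  have h1 : (0 : ℝ) < D.N m := by exact_mod_cast D.N_pos m
  have h2 : (0 : ℝ) < D.N (m + 1) := by exact_mod_cast D.N_pos (m + 1)
  positivity

/-- `0 < s_m`. [folklore] -/
theorem sep16_pos (m : ℕ) : 0 < ((D.N (m + 1) : ℝ) / D.N m) ^ (1 / 16 : ℝ) :=
  Real.rpow_pos_of_pos (ratio_pos D m) _

/-- Natural powers of `s_m` are real powers of the ratio: `s_m ^ n = (N (m+1)/N m) ^ (n/16)`. [folklore] -/
theorem sep16_pow (m n : ℕ) :
    (((D.N (m + 1) : ℝ) / D.N m) ^ (1 / 16 : ℝ)) ^ n = ((D.N (m + 1) : ℝ) / D.N m) ^ ((n : ℝ) / 16) := by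
  rw [← Real.rpow_natCast, ← Real.rpow_mul (ratio_pos D m).le]
  congr 1
  ring

/-- `s_m ^ 16 = N (m+1) / N m`. [folklore] -/
theorem sep16_pow_sixteen (m : ℕ) :
    (((D.N (m + 1) : ℝ) / D.N m) ^ (1 / 16 : ℝ)) ^ 16 = (D.N (m + 1) : ℝ) / D.N m := by
  rw [sep16_pow]
  norm_num

/-- `s_m ^ 4 = (N (m+1) / N m)^{1/4}` — the factor of the viscous windows (T2)/(T3). [folklore] -/
theorem sep16_pow_four (m : ℕ) :
    (((D.N (m + 1) : ℝ) / D.N m) ^ (1 / 16 : ℝ)) ^ 4 = ((D.N (m + 1) : ℝ) / D.N m) ^ (1 / 4 : ℝ) := by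
  rw [sep16_pow]
  norm_num

/-- `N (m+1) = s_m ^ 16 · N m`. [folklore] -/
theorem N_succ_eq_sep16_pow_mul (m : ℕ) :
    (D.N (m + 1) : ℝ) = (((D.N (m + 1) : ℝ) / D.N m) ^ (1 / 16 : ℝ)) ^ 16 * D.N m := by
  have h1 : (D.N m : ℝ) ≠ 0 := by exact_mod_cast (D.N_pos m).ne'
  rw [sep16_pow_sixteen, div_mul_cancel₀ _ h1]

/-- The ratio `ρ_m = N m / N (m+1)` is `(s_m ^ 16)⁻¹`. [folklore] -/
theorem rho_eq_inv_sep16_pow (m : ℕ) :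
    (D.N m : ℝ) / D.N (m + 1) = ((((D.N (m + 1) : ℝ) / D.N m) ^ (1 / 16 : ℝ)) ^ 16)⁻¹ := by
  rw [sep16_pow_sixteen, inv_div]

/-- Under `Permissible` (`2 N m ≤ N (m+1)`): `2 ≤ N (m+1) / N m`. [folklore] -/
theorem two_le_ratio (hP : D.Permissible) (m : ℕ) : (2 : ℝ) ≤ (D.N (m + 1) : ℝ) / D.N m := by
  have h1 : (0 : ℝ) < D.N m := by exact_mod_cast D.N_pos m
  have h2 : (2 : ℝ) * D.N m ≤ D.N (m + 1) := by exact_mod_cast hP.2.2.1 m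
  rw [le_div_iff₀ h1]
  exact h2

/-- Under `Permissible`: `1 ≤ s_m`. [folklore] -/
theorem one_le_sep16 (hP : D.Permissible) (m : ℕ) : 1 ≤ ((D.N (m + 1) : ℝ) / D.N m) ^ (1 / 16 : ℝ) :=
  Real.one_le_rpow (by linarith [two_le_ratio D hP m]) (by norm_num)

/-- Under `Permissible` (`N 0 = 1`, `2 N m ≤ N (m+1)`): `2 ^ m ≤ N m`. [folklore] -/
theorem two_pow_le_N_cast (hP : D.Permissible) (m : ℕ) : (2 : ℝ) ^ m ≤ D.N m := by
  induction m with
  | zero => simp [hP.1]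
  | succ i ih =>
    have h' : (2 : ℝ) * D.N i ≤ D.N (i + 1) := by exact_mod_cast hP.2.2.1 i
    calc (2 : ℝ) ^ (i + 1) = 2 * 2 ^ i := by ring
      _ ≤ 2 * (D.N i : ℝ) := by linarith
      _ ≤ D.N (i + 1) := h'

/-- Super-geometry `N m ^ 2 ≤ N (m+1)` in ratio form: `N m ≤ N (m+1) / N m = s_m ^ 16`. [folklore] -/
theorem N_le_ratio (hsq : ∀ m, D.N m ^ 2 ≤ D.N (m + 1)) (m : ℕ) : (D.N m : ℝ) ≤ (D.N (m + 1) : ℝ) / D.N m := by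
  have h1 : (0 : ℝ) < D.N m := by exact_mod_cast D.N_pos m
  have h2 : (D.N m : ℝ) ^ 2 ≤ D.N (m + 1) := by exact_mod_cast hsq m
  rw [le_div_iff₀ h1]
  nlinarith

/-- `N m ≤ s_m ^ 16`. [folklore] -/
theorem N_le_sep16_pow (hsq : ∀ m, D.N m ^ 2 ≤ D.N (m + 1)) (m : ℕ) :
    (D.N m : ℝ) ≤ (((D.N (m + 1) : ℝ) / D.N m) ^ (1 / 16 : ℝ)) ^ 16 := by
  rw [sep16_pow_sixteen]
  exact N_le_ratio D hsq m

/-- `ρ_m = N m / N (m+1) ≤ 1 / N m`. [folklore] -/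
theorem rho_le_inv_N (hsq : ∀ m, D.N m ^ 2 ≤ D.N (m + 1)) (m : ℕ) : (D.N m : ℝ) / D.N (m + 1) ≤ 1 / D.N m := by
  have h1 : (0 : ℝ) < D.N m := by exact_mod_cast D.N_pos m
  have h2 : (0 : ℝ) < D.N (m + 1) := by exact_mod_cast D.N_pos (m + 1)
  have h3 : (D.N m : ℝ) ^ 2 ≤ D.N (m + 1) := by exact_mod_cast hsq m
  rw [div_le_div_iff₀ h2 h1]
  nlinarith

/-- `ρ_m ≤ 2^{-m}` on the template. [folklore] -/
theorem rho_le_half_pow (hP : D.Permissible) (hsq : ∀ m, D.N m ^ 2 ≤ D.N (m + 1)) (m : ℕ) :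
    (D.N m : ℝ) / D.N (m + 1) ≤ (1 / 2 : ℝ) ^ m := by
  have h1 : (0 : ℝ) < D.N m := by exact_mod_cast D.N_pos m
  calc (D.N m : ℝ) / D.N (m + 1) ≤ 1 / D.N m := rho_le_inv_N D hsq m
    _ ≤ 1 / (2 : ℝ) ^ m := div_le_div_of_nonneg_left zero_le_one (by positivity) (two_pow_le_N_cast D hP m)
    _ = (1 / 2 : ℝ) ^ m := by rw [one_div_pow]

/-- `(2^{1/16}) ^ m ≤ s_m` on the template. [folklore] -/
theorem sixteenthRootTwo_pow_le_sep16 (hP : D.Permissible) (hsq : ∀ m, D.N m ^ 2 ≤ D.N (m + 1)) (m : ℕ) :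
    ((2 : ℝ) ^ (1 / 16 : ℝ)) ^ m ≤ ((D.N (m + 1) : ℝ) / D.N m) ^ (1 / 16 : ℝ) := by
  have h := (two_pow_le_N_cast D hP m).trans (N_le_ratio D hsq m)
  calc ((2 : ℝ) ^ (1 / 16 : ℝ)) ^ m = ((2 : ℝ) ^ m) ^ (1 / 16 : ℝ) := by
        rw [← Real.rpow_natCast, ← Real.rpow_natCast, ← Real.rpow_mul (by norm_num), ← Real.rpow_mul (by norm_num), mul_comm]
    _ ≤ ((D.N (m + 1) : ℝ) / D.N m) ^ (1 / 16 : ℝ) := Real.rpow_le_rpow (by positivity) h (by norm_num)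

/-- **`s_m → ∞`** along the template. [folklore] -/
theorem tendsto_sep16_atTop (hP : D.Permissible) (hsq : ∀ m, D.N m ^ 2 ≤ D.N (m + 1)) :
    Tendsto (fun m => ((D.N (m + 1) : ℝ) / D.N m) ^ (1 / 16 : ℝ)) atTop atTop := by
  have h2 : (1 : ℝ) < (2 : ℝ) ^ (1 / 16 : ℝ) := Real.one_lt_rpow (by norm_num) (by norm_num)
  exact tendsto_atTop_mono (sixteenthRootTwo_pow_le_sep16 D hP hsq) (tendsto_pow_atTop_atTop_of_one_lt h2)

/-- Threshold form: every bound is eventually below `s_m`. [folklore] -/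
theorem exists_forall_le_sep16 (hP : D.Permissible) (hsq : ∀ m, D.N m ^ 2 ≤ D.N (m + 1)) (B : ℝ) :
    ∃ mstar : ℕ, ∀ m, mstar ≤ m → B ≤ ((D.N (m + 1) : ℝ) / D.N m) ^ (1 / 16 : ℝ) :=
  eventually_atTop.1 ((tendsto_sep16_atTop D hP hsq).eventually_ge_atTop B)

/-- Threshold form for natural powers: every bound is eventually below `s_m ^ n` (`n ≥ 1`). [folklore] -/
theorem exists_forall_le_sep16_pow (hP : D.Permissible) (hsq : ∀ m, D.N m ^ 2 ≤ D.N (m + 1)) (B : ℝ) {n : ℕ} (hn : n ≠ 0) :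
    ∃ mstar : ℕ, ∀ m, mstar ≤ m → B ≤ (((D.N (m + 1) : ℝ) / D.N m) ^ (1 / 16 : ℝ)) ^ n := by
  obtain ⟨mstar, h⟩ := exists_forall_le_sep16 D hP hsq (max B 1)
  refine ⟨mstar, fun m hm => ?_⟩
  have hs := h m hm
  have h1 : 1 ≤ ((D.N (m + 1) : ℝ) / D.N m) ^ (1 / 16 : ℝ) := (le_max_right _ _).trans hs
  calc B ≤ ((D.N (m + 1) : ℝ) / D.N m) ^ (1 / 16 : ℝ) := (le_max_left _ _).trans hs
    _ = (((D.N (m + 1) : ℝ) / D.N m) ^ (1 / 16 : ℝ)) ^ 1 := (pow_one _).symm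
    _ ≤ (((D.N (m + 1) : ℝ) / D.N m) ^ (1 / 16 : ℝ)) ^ n := pow_le_pow_right₀ h1 (Nat.one_le_iff_ne_zero.mpr hn)

/-- **`ρ_m → 0`** along the template. [folklore] -/
theorem tendsto_rho_zero (hP : D.Permissible) (hsq : ∀ m, D.N m ^ 2 ≤ D.N (m + 1)) :
    Tendsto (fun m => (D.N m : ℝ) / D.N (m + 1)) atTop (𝓝 0) := by
  have hhalf : Tendsto (fun m : ℕ => (1 / 2 : ℝ) ^ m) atTop (𝓝 0) :=
    tendsto_pow_atTop_nhds_zero_of_lt_one (by norm_num) (by norm_num)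
  refine squeeze_zero (fun m => ?_) (rho_le_half_pow D hP hsq) hhalf
  have h1 : (0 : ℝ) < D.N m := by exact_mod_cast D.N_pos m
  have h2 : (0 : ℝ) < D.N (m + 1) := by exact_mod_cast D.N_pos (m + 1)
  positivity

/-- **The error law is eventually small**: for every `σ > 0`, `C` and `ε > 0` there is `m⋆` with `C · ρ_m ^ σ ≤ ε` for all `m ≥ m⋆`
(the `1 − C₁ ρ_m^{σ₁}` of `stub_oneLevelL_IW` is eventually `≥ 1 − ε`). [folklore] -/
theorem exists_forall_mul_rho_rpow_le (hP : D.Permissible) (hsq : ∀ m, D.N m ^ 2 ≤ D.N (m + 1)) (C : ℝ) {σ : ℝ} (hσ : 0 < σ)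
    {ε : ℝ} (hε : 0 < ε) :
    ∃ mstar : ℕ, ∀ m, mstar ≤ m → C * ((D.N m : ℝ) / D.N (m + 1)) ^ σ ≤ ε := by
  have hρ := tendsto_rho_zero D hP hsq
  have hpow : Tendsto (fun m => ((D.N m : ℝ) / D.N (m + 1)) ^ σ) atTop (𝓝 0) := by
    have h0 : (0 : ℝ) ^ σ = 0 := Real.zero_rpow hσ.ne'
    rw [← h0]
    exact hρ.rpow_const (Or.inr hσ.le)
  have hmul : Tendsto (fun m => C * ((D.N m : ℝ) / D.N (m + 1)) ^ σ) atTop (𝓝 (C * 0)) := hpow.const_mul C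
  rw [mul_zero] at hmul
  exact eventually_atTop.1 (hmul.eventually (eventually_le_nhds hε))

/-! ## § 2. The cell viscosity of level `m+1` is pinched by the template -/

/-- (T2) in the variable `s`: `cellVisc (m+1) · s_m ^ 4 ≤ 1`. [folklore] -/
theorem cellVisc_succ_mul_sep16_pow_four_le_one
    (hT2 : ∀ m, D.cellVisc (m + 1) * ((D.N (m + 1) : ℝ) / D.N m) ^ (1 / 4 : ℝ) ≤ 1) (m : ℕ) :
    D.cellVisc (m + 1) * (((D.N (m + 1) : ℝ) / D.N m) ^ (1 / 16 : ℝ)) ^ 4 ≤ 1 := by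
  rw [sep16_pow_four]
  exact hT2 m

/-- (T2): `cellVisc (m+1) ≤ 1 / s_m ^ 4`. [folklore] -/
theorem cellVisc_succ_le_inv_sep16_pow_four
    (hT2 : ∀ m, D.cellVisc (m + 1) * ((D.N (m + 1) : ℝ) / D.N m) ^ (1 / 4 : ℝ) ≤ 1) (m : ℕ) :
    D.cellVisc (m + 1) ≤ 1 / (((D.N (m + 1) : ℝ) / D.N m) ^ (1 / 16 : ℝ)) ^ 4 := by
  rw [le_div_iff₀ (pow_pos (sep16_pos D m) 4)]
  exact cellVisc_succ_mul_sep16_pow_four_le_one D hT2 m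

/-- (T3) in the variable `s`: `K · s_m ^ 4 ≤ s_m ^ 16 · cellVisc (m+1)`. [folklore] -/
theorem K_mul_sep16_pow_four_le
    (hT3 : ∀ m, D.K * ((D.N (m + 1) : ℝ) / D.N m) ^ (1 / 4 : ℝ) ≤ ((D.N (m + 1) : ℝ) / D.N m) * D.cellVisc (m + 1)) (m : ℕ) :
    D.K * (((D.N (m + 1) : ℝ) / D.N m) ^ (1 / 16 : ℝ)) ^ 4 ≤
      (((D.N (m + 1) : ℝ) / D.N m) ^ (1 / 16 : ℝ)) ^ 16 * D.cellVisc (m + 1) := by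
  rw [sep16_pow_four, sep16_pow_sixteen]
  exact hT3 m

/-- (T3): `K ≤ s_m ^ 12 · cellVisc (m+1)`. [folklore] -/
theorem K_le_sep16_pow_twelve_mul_cellVisc_succ
    (hT3 : ∀ m, D.K * ((D.N (m + 1) : ℝ) / D.N m) ^ (1 / 4 : ℝ) ≤ ((D.N (m + 1) : ℝ) / D.N m) * D.cellVisc (m + 1)) (m : ℕ) :
    D.K ≤ (((D.N (m + 1) : ℝ) / D.N m) ^ (1 / 16 : ℝ)) ^ 12 * D.cellVisc (m + 1) := by
  have hs := sep16_pos D m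
  have h := K_mul_sep16_pow_four_le D hT3 m
  have e : (((D.N (m + 1) : ℝ) / D.N m) ^ (1 / 16 : ℝ)) ^ 16 * D.cellVisc (m + 1) =
      ((((D.N (m + 1) : ℝ) / D.N m) ^ (1 / 16 : ℝ)) ^ 12 * D.cellVisc (m + 1)) * (((D.N (m + 1) : ℝ) / D.N m) ^ (1 / 16 : ℝ)) ^ 4 := by
    ring
  rw [e] at h
  exact le_of_mul_le_mul_right h (pow_pos hs 4)

/-- (T3): `K / s_m ^ 12 ≤ cellVisc (m+1)`. [folklore] -/
theorem K_div_sep16_pow_twelve_le_cellVisc_succ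
    (hT3 : ∀ m, D.K * ((D.N (m + 1) : ℝ) / D.N m) ^ (1 / 4 : ℝ) ≤ ((D.N (m + 1) : ℝ) / D.N m) * D.cellVisc (m + 1)) (m : ℕ) :
    D.K / (((D.N (m + 1) : ℝ) / D.N m) ^ (1 / 16 : ℝ)) ^ 12 ≤ D.cellVisc (m + 1) := by
  rw [div_le_iff₀ (pow_pos (sep16_pos D m) 12), mul_comm]
  exact K_le_sep16_pow_twelve_mul_cellVisc_succ D hT3 m

/-- (T3): the Bloch number of level `m+1` is at most `s_m ^ 12`: `K / cellVisc (m+1) ≤ s_m ^ 12`. [folklore] -/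
theorem K_div_cellVisc_succ_le_sep16_pow_twelve
    (hT3 : ∀ m, D.K * ((D.N (m + 1) : ℝ) / D.N m) ^ (1 / 4 : ℝ) ≤ ((D.N (m + 1) : ℝ) / D.N m) * D.cellVisc (m + 1)) (m : ℕ) :
    D.K / D.cellVisc (m + 1) ≤ (((D.N (m + 1) : ℝ) / D.N m) ^ (1 / 16 : ℝ)) ^ 12 := by
  rw [div_le_iff₀ (cellVisc_pos' D (m + 1))]
  exact K_le_sep16_pow_twelve_mul_cellVisc_succ D hT3 m

/-- (T3): `⌈K / cellVisc (m+1)⌉₊ ≤ s_m ^ 12 + 1`. [folklore] -/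
theorem ceil_K_div_cellVisc_succ_le
    (hT3 : ∀ m, D.K * ((D.N (m + 1) : ℝ) / D.N m) ^ (1 / 4 : ℝ) ≤ ((D.N (m + 1) : ℝ) / D.N m) * D.cellVisc (m + 1)) (m : ℕ) :
    (⌈D.K / D.cellVisc (m + 1)⌉₊ : ℝ) ≤ (((D.N (m + 1) : ℝ) / D.N m) ^ (1 / 16 : ℝ)) ^ 12 + 1 := by
  have h0 : 0 ≤ D.K / D.cellVisc (m + 1) := div_nonneg D.K_pos.le (cellVisc_pos' D (m + 1)).le
  have h1 := Nat.ceil_lt_add_one h0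
  linarith [K_div_cellVisc_succ_le_sep16_pow_twelve D hT3 m]

/-- (T2) and (T3) together: `K ≤ s_m ^ 8` (the template forces the separation to dominate the Bloch constant). [folklore] -/
theorem K_le_sep16_pow_eight
    (hT2 : ∀ m, D.cellVisc (m + 1) * ((D.N (m + 1) : ℝ) / D.N m) ^ (1 / 4 : ℝ) ≤ 1)
    (hT3 : ∀ m, D.K * ((D.N (m + 1) : ℝ) / D.N m) ^ (1 / 4 : ℝ) ≤ ((D.N (m + 1) : ℝ) / D.N m) * D.cellVisc (m + 1)) (m : ℕ) :
    D.K ≤ (((D.N (m + 1) : ℝ) / D.N m) ^ (1 / 16 : ℝ)) ^ 8 := by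
  have hs := sep16_pos D m
  have h1 := K_le_sep16_pow_twelve_mul_cellVisc_succ D hT3 m
  have h2 := cellVisc_succ_mul_sep16_pow_four_le_one D hT2 m
  have h4 : 0 < (((D.N (m + 1) : ℝ) / D.N m) ^ (1 / 16 : ℝ)) ^ 4 := pow_pos hs 4
  calc D.K ≤ (((D.N (m + 1) : ℝ) / D.N m) ^ (1 / 16 : ℝ)) ^ 12 * D.cellVisc (m + 1) := h1
    _ = (((D.N (m + 1) : ℝ) / D.N m) ^ (1 / 16 : ℝ)) ^ 8 *
          (D.cellVisc (m + 1) * (((D.N (m + 1) : ℝ) / D.N m) ^ (1 / 16 : ℝ)) ^ 4) := by ring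
    _ ≤ (((D.N (m + 1) : ℝ) / D.N m) ^ (1 / 16 : ℝ)) ^ 8 * 1 := mul_le_mul_of_nonneg_left h2 (pow_pos hs 8).le
    _ = (((D.N (m + 1) : ℝ) / D.N m) ^ (1 / 16 : ℝ)) ^ 8 := mul_one _

/-- **The active band fits under the Bloch threshold.**  If `L ≤ N m · s_m ^ 2` (i.e. `L ≤ N m · ρ_m^{-1/8}`, the active band of the one-level
step) and `2 ≤ s_m ^ 2`, then `L · ⌈K / cellVisc (m+1)⌉₊ ≤ N (m+1)` — the separation hypothesis of the cell clauses at `ν = cellVisc (m+1)`,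
`n = N (m+1)`. [folklore] -/
theorem activeBand_mul_ceil_le_N_succ
    (hT3 : ∀ m, D.K * ((D.N (m + 1) : ℝ) / D.N m) ^ (1 / 4 : ℝ) ≤ ((D.N (m + 1) : ℝ) / D.N m) * D.cellVisc (m + 1)) (m : ℕ)
    {L : ℝ} (hL : L ≤ (D.N m : ℝ) * (((D.N (m + 1) : ℝ) / D.N m) ^ (1 / 16 : ℝ)) ^ 2)
    (hs2 : 2 ≤ (((D.N (m + 1) : ℝ) / D.N m) ^ (1 / 16 : ℝ)) ^ 2) :
    L * (⌈D.K / D.cellVisc (m + 1)⌉₊ : ℝ) ≤ D.N (m + 1) := by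
  set s : ℝ := ((D.N (m + 1) : ℝ) / D.N m) ^ (1 / 16 : ℝ) with hs_def
  have hs : 0 < s := sep16_pos D m
  have hN : (0 : ℝ) < D.N m := by exact_mod_cast D.N_pos m
  have hceil := ceil_K_div_cellVisc_succ_le D hT3 m
  rw [← hs_def] at hceil
  have hc0 : (0 : ℝ) ≤ (⌈D.K / D.cellVisc (m + 1)⌉₊ : ℝ) := Nat.cast_nonneg _
  -- `s² (s¹² + 1) ≤ s¹⁶` from `2 ≤ s²`
  have hkey : s ^ 2 * (s ^ 12 + 1) ≤ s ^ 16 := by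
    have h14 : s ^ 2 ≤ s ^ 14 := by
      have h1 : 1 ≤ s := by nlinarith [hs]
      exact pow_le_pow_right₀ h1 (by norm_num)
    nlinarith [pow_pos hs 14]
  calc L * (⌈D.K / D.cellVisc (m + 1)⌉₊ : ℝ) ≤ ((D.N m : ℝ) * s ^ 2) * (s ^ 12 + 1) :=
        mul_le_mul hL hceil hc0 (by positivity)
    _ = (D.N m : ℝ) * (s ^ 2 * (s ^ 12 + 1)) := by ring
    _ ≤ (D.N m : ℝ) * s ^ 16 := mul_le_mul_of_nonneg_left hkey hN.le
    _ = D.N (m + 1) := by rw [hs_def, mul_comm, ← N_succ_eq_sep16_pow_mul]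

/-- **`cellVisc (m+1) → 0`** along the template ((T2) + super-geometry + `Permissible`). [folklore] -/
theorem tendsto_cellVisc_succ_zero (hP : D.Permissible)
    (hT2 : ∀ m, D.cellVisc (m + 1) * ((D.N (m + 1) : ℝ) / D.N m) ^ (1 / 4 : ℝ) ≤ 1)
    (hsq : ∀ m, D.N m ^ 2 ≤ D.N (m + 1)) :
    Tendsto (fun m => D.cellVisc (m + 1)) atTop (𝓝 0) := by
  have hq0 : 0 ≤ (1 / 2 : ℝ) ^ (1 / 4 : ℝ) := Real.rpow_nonneg (by norm_num) _
  have hq1 : (1 / 2 : ℝ) ^ (1 / 4 : ℝ) < 1 := Real.rpow_lt_one (by norm_num) (by norm_num) (by norm_num)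
  exact squeeze_zero (fun m => (cellVisc_pos' D (m + 1)).le)
    (LagrangianRenormalisationStep.cellVisc_succ_le_half_pow D hP hT2 hsq) (tendsto_pow_atTop_nhds_zero_of_lt_one hq0 hq1)

/-- Threshold form: `cellVisc (m+1) < ν₀` for all large `m`, for every `ν₀ > 0`. [folklore] -/
theorem exists_forall_cellVisc_succ_lt (hP : D.Permissible)
    (hT2 : ∀ m, D.cellVisc (m + 1) * ((D.N (m + 1) : ℝ) / D.N m) ^ (1 / 4 : ℝ) ≤ 1)
    (hsq : ∀ m, D.N m ^ 2 ≤ D.N (m + 1)) {ν₀ : ℝ} (hν₀ : 0 < ν₀) :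
    ∃ mstar : ℕ, ∀ m, mstar ≤ m → D.cellVisc (m + 1) < ν₀ :=
  eventually_atTop.1 ((tendsto_cellVisc_succ_zero D hP hT2 hsq).eventually (eventually_lt_nhds hν₀))

end Summit.AnomalousDissipation.AnomalousDissipation.Theorems.SolenoidalFractalHomogenisation.LagrangianStep

end
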